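import Literature.AnabelianGeometry.AbsoluteAnabelian.MLFGaloisUnitsRigidityProofs
import HarnessLib

/-!
# Equivariant GROUP endomorphisms of `k̄^×` over the identity of `G_k` are power maps `x ↦ xᴹ`, `M ∈ ℤ`

Proof-only companion (theorems only, no definitions) of `MonoidKummerMaps.lean` (abc-iut-L4-t2), of
abc-iut-L6-t13's `MLFGaloisUnitsRigidityProofs.lean` and of `MonoidKummerEndomorphismsArePowers.lean`
(abc-iut-L4-t2 gen 10); S. Mochizuki, *Topics in Absolute Anabelian Geometry III*, Def. 3.1 (ii) p. 67
(morphisms of MLF-Galois `TLG`-pairs `(Π ↷ k̄^×)`: a morphism of topological groups `φ_M` compatible with a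
`φ_Π` inducing an open injection of arithmetic Galois groups) and Prop. 3.3 (ii) p. 74 ("if `T = TLG`, then
the resulting map `Isom((Π ↷ M),(Π* ↷ M*)) → Isom(Π, Π*)` is surjective, with fibers of cardinality two")
(bib key `MochizukiAbsTopIII2015`, lit key `paper:url-5493eb38cbb7`).

THE POINT.  `MLFGaloisUnitsRigidityProofs` proves: a `G_k`-equivariant AUTOMORPHISM of the model `TLG`-object
`k̄^×` (`nonZeroDivisors k̄`) over `id_{G_k}` is the identity or the inversion
(`MLFClosure.nonZeroDivisors_mulEquiv_eq_self_or_eq_inv` — the fibre `{±1}`; second proof: abc-iut-L6-d1's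
`MLFClosure.nonZeroDivisors_equivariant_eq_id_or_inv`, `AbsTopIII/EquivariantSignRigidity.lean`; the `TCG` object
`𝒪_k̄^×`, whose equivariant automorphisms are the `Ẑ^×`-powers, is `AbsTopIII/EquivariantUnitAutomorphisms.lean` /
`…Exponents.lean`).
`MonoidKummerEndomorphismsArePowers` proves: a `G_k`-equivariant monoid ENDOmorphism of the `TM`-object
`𝒪_k̄^⊳` over `id_{G_k}` is `x ↦ xᴹ` with `M ∈ ℕ` (`MLFClosure.nonzeroIntegers_monoidHom_eq_pow`).  This file is
the common generalisation for the GROUP `k̄^×`: the same Kummer argument, run for a group ENDOmorphism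
`γ : k̄^× →* k̄^×` (no inverse, no integrality), gives

* `MLFClosure.unitsHom_exists_pow_eq_on_rootsOfUnity` (Step 1), `MLFClosure.unitsHom_exists_kummer_relation`
  (Step 2): the `→*` versions of L6-t13's Steps 1–2 (same proofs — adapted from
  `MLFGaloisUnitsRigidityProofs.lean`);
* `MLFClosure.unitsHom_exists_exponent_congr` (Step 3′): for a uniformiser `ϖ ∈ k`, `γ(ϖ) ∈ k^×` is
  `G_k`-fixed; with `M := -ord_k γ(ϖ) ∈ ℤ` (normalised so that `ord_k ϖ = -1`; NO sign constraint, `k̄^×` being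
  a group), the exponent `m_n` by which `γ` acts on `μ_n(k̄)` satisfies `m_n ≡ M (mod n)` for EVERY `n`;
* **`MLFClosure.nonZeroDivisors_monoidHom_eq_zpow`** (Step 4′): **`γ(x) = xᴹ` for every `x ∈ k̄^×`** — for
  `x ∈ k̄^×`, `γ(x)/xᴹ = (β xᵗ)ⁿ` lies in `⋂ₙ (k(x)ˣ)ⁿ = 1`, `k(x)` being a non-archimedean local field
  (abc-iut-L4-t11's `FiniteExtension.isNonarchimedeanLocalField`,
  `GaloisRepresentations.eq_one_of_forall_exists_pow_eq`); the exponent is unique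
  (`MLFClosure.zpow_exponent_unique`), every `M ∈ ℤ` occurs (`MLFClosure.exists_equivariant_unitsHom_zpow`),
  and composition multiplies exponents (`MLFClosure.zpow_exponent_comp`, `…_monoidHom_comm`), so
  `End((G_k ↷ k̄^×))` over `id_{G_k}` is `{x ↦ xᴹ : M ∈ ℤ} ≅ (ℤ, ·)`, a commutative monoid;
* the sequel `MLFGaloisUnitsEndomorphismsCorollaries.lean` draws the consequences: injective ⟺ bijective ⟺
  `γ = id` or `γ = (·)⁻¹` (`M = ±1` — the `→*` form of L6-t13's fibre-two theorem: the fibre is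
  `End ∩ Aut = ℤˣ`), surjective ⟺ `γ ≠ 1` (`M ≠ 0`), fixing `μ_∞` ⟹ `γ = id`, the `TM`/`TLG` bridge (`x ↦ xᴹ`
  preserves `𝒪_k̄^⊳` iff `0 ≤ M`, so the endomorphisms of the `TLG`-pair restricting to the `TM`-pair are gen 10's
  `ℕ ⊂ ℤ`), and the same statements for endomorphisms of the model `TLG`-pair `(Π_k ↷ k̄^×)` covering `id_{G_k}`.

HONEST FRAMING: OUR kernel check of classical Kummer theory over a `p`-adic field (Neukirch, *Algebraic
Number Theory*, Ch. II Prop. 5.7 / Ch. IV §3 for the ingredients); a statement about the cell's typed model of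
the category of [AbsTopIII] Def. 3.1; count-neutral for the node Prop. 3.3 (ii) (discharged of record);
nothing here bears on [IUTchIII] Cor. 3.12; no side is taken; nothing asserts that abc is proved or refuted.
-/

noncomputable section

open scoped Classical

namespace Literature.AnabelianGeometry.AbsoluteAnabelian

open _root_.ValuativeRel IntermediateField
open Literature.NumberTheory.GaloisRepresentations

universe u

namespace MLFClosure

variable {C : MLFClosure.{u}}

/-! ## Step 0: equivariance bookkeeping for an endomorphism of `k̄^×` -/

/-- An equivariant group ENDOmorphism `γ` of `k̄^×` over the identity of `G_k` maps `σ`-fixed elements to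
`σ`-fixed elements. [cite: MochizukiAbsTopIII2015, Definition 3.1 (ii) p.67] -/
theorem unitsHom_equivariant_apply_eq_of_fixed
    {γ : ↥(nonZeroDivisors C.K) →* ↥(nonZeroDivisors C.K)}
    (hγ : ∀ (σ : C.K ≃ₐ[C.k] C.K) (x : ↥(nonZeroDivisors C.K)),
      (γ ⟨σ • (x : C.K), smul_mem_nonZeroDivisors σ x.2⟩ : C.K) = σ • (γ x : C.K))
    {σ : C.K ≃ₐ[C.k] C.K} {x : ↥(nonZeroDivisors C.K)} (hx : σ (x : C.K) = x) :
    σ (γ x : C.K) = γ x := by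
  have h := hγ σ x
  have hsub : (⟨σ • (x : C.K), smul_mem_nonZeroDivisors σ x.2⟩ : ↥(nonZeroDivisors C.K)) = x :=
    Subtype.ext (show σ • (x : C.K) = x by rw [AlgEquiv.smul_def, hx])
  rw [hsub, AlgEquiv.smul_def] at h
  exact h.symm

/-! ## Step 1: roots of unity -/

variable (C) in
/-- STEP 1 (endomorphism version). For `n ≥ 1` there is `m : ℕ` with `γ u = u ^ m` for every `u ∈ k̄^×` with
`uⁿ = 1` (`γ` maps the cyclic group `μ_n(k̄)` into itself). Adapted from `MLFGaloisUnitsRigidityProofs.lean`.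
[cite: MochizukiAbsTopIII2015, Proposition 3.3 (ii) p.74] -/
theorem unitsHom_exists_pow_eq_on_rootsOfUnity (γ : ↥(nonZeroDivisors C.K) →* ↥(nonZeroDivisors C.K))
    {n : ℕ} (hn : 0 < n) :
    ∃ m : ℕ, ∀ u : ↥(nonZeroDivisors C.K), (u : C.K) ^ n = 1 → γ u = u ^ m := by
  haveI : IsAlgClosed C.K := IsAlgClosure.isAlgClosed C.k
  haveI : CharZero C.K := charZero_of_injective_algebraMap (algebraMap C.k C.K).injective
  haveI : NeZero n := ⟨hn.ne'⟩
  obtain ⟨ζ, hζ⟩ := HasEnoughRootsOfUnity.exists_primitiveRoot C.K n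
  set u₀ : ↥(nonZeroDivisors C.K) :=
    ⟨ζ, C.mem_nonZeroDivisors_of_pow_eq hn (Submonoid.one_mem _) hζ.pow_eq_one⟩ with hu₀
  have hγu₀ : ((γ u₀ : ↥(nonZeroDivisors C.K)) : C.K) ^ n = 1 := by
    have h1 : u₀ ^ n = 1 := Subtype.ext (by
      rw [SubmonoidClass.coe_pow, hu₀]; exact hζ.pow_eq_one)
    have h2 : (γ u₀) ^ n = 1 := by rw [← map_pow, h1, map_one]
    have h3 := congrArg (fun z : ↥(nonZeroDivisors C.K) => (z : C.K)) h2
    simpa using h3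
  obtain ⟨m, -, hm⟩ := hζ.eq_pow_of_pow_eq_one hγu₀
  refine ⟨m, fun u hu => ?_⟩
  obtain ⟨i, -, hi⟩ := hζ.eq_pow_of_pow_eq_one hu
  have hu' : u = u₀ ^ i := Subtype.ext (by rw [SubmonoidClass.coe_pow, hu₀]; exact hi.symm)
  have hγu₀' : γ u₀ = u₀ ^ m := Subtype.ext (by rw [SubmonoidClass.coe_pow, hu₀]; exact hm.symm)
  rw [hu', map_pow, hγu₀', ← pow_mul, ← pow_mul, mul_comm]

/-! ## Step 2: the Kummer relation -/

/-- STEP 2 (Kummer, endomorphism version). Let `γ` be equivariant and act on `μ_n` by the `m`-th power.  Then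
for every `x ∈ k̄^×` there is `β ∈ k̄^×`, fixed by every `τ ∈ G_k` fixing `x`, with `γ(x) = βⁿ · x^m`.
Adapted from `MLFGaloisUnitsRigidityProofs.lean`. [cite: MochizukiAbsTopIII2015, Proposition 3.3 (ii) p.74] -/
theorem unitsHom_exists_kummer_relation
    {γ : ↥(nonZeroDivisors C.K) →* ↥(nonZeroDivisors C.K)}
    (hγ : ∀ (σ : C.K ≃ₐ[C.k] C.K) (x : ↥(nonZeroDivisors C.K)),
      (γ ⟨σ • (x : C.K), smul_mem_nonZeroDivisors σ x.2⟩ : C.K) = σ • (γ x : C.K))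
    {n m : ℕ} (hn : 0 < n)
    (hm : ∀ u : ↥(nonZeroDivisors C.K), (u : C.K) ^ n = 1 → γ u = u ^ m)
    (x : ↥(nonZeroDivisors C.K)) :
    ∃ β : C.K, β ≠ 0 ∧ (∀ τ : C.K ≃ₐ[C.k] C.K, τ (x : C.K) = x → τ β = β) ∧
      (γ x : C.K) = β ^ n * (x : C.K) ^ m := by
  haveI : IsAlgClosed C.K := IsAlgClosure.isAlgClosed C.k
  have hx0 : (x : C.K) ≠ 0 := nonZeroDivisors.coe_ne_zero x
  obtain ⟨y, hy⟩ := IsAlgClosed.exists_pow_nat_eq (x : C.K) hn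
  have hyM : y ∈ nonZeroDivisors C.K := C.mem_nonZeroDivisors_of_pow_eq hn x.2 hy
  have hy0 : y ≠ 0 := nonZeroDivisors.ne_zero hyM
  set yM : ↥(nonZeroDivisors C.K) := ⟨y, hyM⟩ with hyMdef
  have hxy : x = yM ^ n := Subtype.ext (by rw [SubmonoidClass.coe_pow, hyMdef]; exact hy.symm)
  set β : C.K := (γ yM : C.K) / y ^ m with hβ
  have hγy0 : (γ yM : C.K) ≠ 0 := nonZeroDivisors.coe_ne_zero (γ yM)
  have hβ0 : β ≠ 0 := div_ne_zero hγy0 (pow_ne_zero _ hy0)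
  refine ⟨β, hβ0, fun τ hτ => ?_, ?_⟩
  · -- `τ y = ζ y` with `ζⁿ = 1`
    set ζ : C.K := τ y / y with hζ
    have hζn : ζ ^ n = 1 := by
      rw [hζ, div_pow, ← map_pow, hy, hτ, div_self hx0]
    have hζM : ζ ∈ nonZeroDivisors C.K :=
      C.mem_nonZeroDivisors_of_pow_eq hn (Submonoid.one_mem _) hζn
    set ζM : ↥(nonZeroDivisors C.K) := ⟨ζ, hζM⟩ with hζMdef
    have hτy : τ y = ζ * y := by rw [hζ, div_mul_cancel₀ _ hy0]
    have h1 := hγ τ yM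
    have h2 : (⟨τ • (yM : C.K), smul_mem_nonZeroDivisors τ yM.2⟩ : ↥(nonZeroDivisors C.K)) =
        ζM * yM := Subtype.ext (by
      show τ • y = ζ * y
      rw [AlgEquiv.smul_def, hτy])
    rw [h2, map_mul, hm ζM hζn, AlgEquiv.smul_def] at h1
    have h3 : τ (γ yM : C.K) = ζ ^ m * (γ yM : C.K) := by
      rw [← h1, Submonoid.coe_mul, SubmonoidClass.coe_pow]
    have hζ0 : ζ ≠ 0 := nonZeroDivisors.ne_zero hζM
    rw [hβ, map_div₀, map_pow, h3, hτy, mul_pow]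
    exact mul_div_mul_left _ _ (pow_ne_zero _ hζ0)
  · -- `γ x = γ (yⁿ) = (γ y)ⁿ = (β y^m)ⁿ = βⁿ x^m`
    have hγy : (γ yM : C.K) = β * y ^ m := by rw [hβ, div_mul_cancel₀ _ (pow_ne_zero _ hy0)]
    rw [hxy, map_pow, SubmonoidClass.coe_pow, hγy, mul_pow, ← pow_mul, SubmonoidClass.coe_pow,
      hyMdef, ← pow_mul, mul_comm m n]

/-! ## Step 3′: the valuation of `k` pins the exponents modulo every `n` -/

/-- The normalised additive valuation of a non-archimedean local field, packaged as data: `ord : k → ℤ`,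
additive on non-zero elements, `≤ 0` on `𝒪_k ∖ 0`, `= -1` at a uniformiser `ϖ ∈ 𝒪_k` (copy of the private
lemma of `MonoidKummerEndomorphismsArePowers.lean`). Ref: Serre, *Local Fields*, Ch. II §1. [folklore] -/
private theorem exists_ord' (k : Type u) [Field k] [ValuativeRel k] [TopologicalSpace k]
    [IsNonarchimedeanLocalField k] :
    ∃ (ord : k → ℤ) (ϖ : k), ϖ ≠ 0 ∧ ϖ ∈ 𝒪[k] ∧ ord ϖ = -1 ∧
      (∀ a b : k, a ≠ 0 → b ≠ 0 → ord (a * b) = ord a + ord b) ∧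
      (∀ (a : k) (n : ℕ), a ≠ 0 → ord (a ^ n) = n * ord a) ∧
      (∀ a : k, a ≠ 0 → a ∈ 𝒪[k] → ord a ≤ 0) := by
  set e := _root_.IsNonarchimedeanLocalField.valueGroupWithZeroIsoInt k with he
  refine ⟨fun a => WithZero.log (e (valuation k a)), ?_⟩
  obtain ⟨ϖ, hϖ⟩ := exists_units_isUniformizer (F := k)
  have hne : ∀ a : k, a ≠ 0 → e (valuation k a) ≠ 0 := fun a ha h =>
    ((Valuation.ne_zero_iff _).mpr ha) (e.injective (h.trans (map_zero e).symm))
  refine ⟨(ϖ : k), ϖ.ne_zero, le_of_lt hϖ.val_lt_one, ?_, ?_, ?_, ?_⟩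
  · show WithZero.log (e (valuation k (ϖ : k))) = -1
    rw [hϖ.val, IsNonarchimedeanLocalField.valueGroupWithZeroIsoInt_generator, WithZero.log_exp]
  · intro a b ha hb
    show WithZero.log (e (valuation k (a * b))) = WithZero.log (e (valuation k a)) +
      WithZero.log (e (valuation k b))
    rw [map_mul, map_mul, WithZero.log_mul (hne a ha) (hne b hb)]
  · intro a n ha
    show WithZero.log (e (valuation k (a ^ n))) = n * WithZero.log (e (valuation k a))
    rw [map_pow, map_pow, WithZero.log_pow, nsmul_eq_mul]
  · intro a ha hint
    show WithZero.log (e (valuation k a)) ≤ 0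
    rw [WithZero.log_le_iff_le_exp (hne a ha), WithZero.exp_zero, ← map_one e, map_le_map_iff]
    exact hint

/-- An element of `k̄` fixed by every element of `G_k` lies in `k` (infinite Galois theory for `k̄/k`; copy of
the private lemma of `MonoidKummerMapsProofs.lean`). [folklore] -/
private theorem exists_algebraMap_eq_of_fixed' {y : C.K} (hfix : ∀ σ : C.K ≃ₐ[C.k] C.K, σ y = y) :
    ∃ a : C.k, algebraMap C.k C.K a = y := by
  have h : y ∈ IntermediateField.fixedField (⊥ : IntermediateField C.k C.K).fixingSubgroup := by
    rw [IntermediateField.fixingSubgroup_bot, IntermediateField.mem_fixedField_iff]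
    exact fun σ _ => hfix σ
  rw [InfiniteGalois.fixedField_fixingSubgroup, IntermediateField.mem_bot] at h
  exact h

/-- An element of `k̄` fixed by every `τ ∈ G_k` that fixes `x` lies in `k(x)` (infinite Galois correspondence;
copy of the private lemma of `MonoidKummerMapsProofs.lean`). [folklore] -/
private theorem mem_adjoin_of_fixed' {x y : C.K}
    (h : ∀ τ : C.K ≃ₐ[C.k] C.K, τ x = x → τ y = y) :
    y ∈ IntermediateField.adjoin C.k ({x} : Set C.K) := by
  rw [← InfiniteGalois.fixedField_fixingSubgroup (IntermediateField.adjoin C.k ({x} : Set C.K)),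
    IntermediateField.mem_fixedField_iff]
  intro τ hτ
  exact h τ ((IntermediateField.mem_fixingSubgroup_iff _ _).mp hτ x
    (IntermediateField.mem_adjoin_simple_self C.k x))

/-- STEP 3′ (the exponents are congruent to ONE integer `M` modulo every `n`).  Let `γ` be an equivariant group
endomorphism of `k̄^×` and `ϖ ∈ k` a uniformiser.  Then `γ(ϖ) ∈ k^×` (it is `G_k`-fixed), and with
`M := -ord_k γ(ϖ) ∈ ℤ` (normalisation `ord_k ϖ = -1`): for every `n ≥ 1`, with `γ = (·)^m` on `μ_n(k̄)`, the
Kummer relation `γ(ϖ) = βⁿ ϖ^m` (`β ∈ k`) gives `(m : ℤ) = n·t + M`.  (For the monoid `𝒪_k̄^⊳` one has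
moreover `0 ≤ M`, `MLFClosure.hom_exists_exponent_congr`; for the group `k̄^×` the sign of `M` is free.)
[cite: MochizukiAbsTopIII2015, Proposition 3.3 (ii) p.74] -/
theorem unitsHom_exists_exponent_congr
    {γ : ↥(nonZeroDivisors C.K) →* ↥(nonZeroDivisors C.K)}
    (hγ : ∀ (σ : C.K ≃ₐ[C.k] C.K) (x : ↥(nonZeroDivisors C.K)),
      (γ ⟨σ • (x : C.K), smul_mem_nonZeroDivisors σ x.2⟩ : C.K) = σ • (γ x : C.K)) :
    ∃ M : ℤ, ∀ n : ℕ, 0 < n → ∃ (m : ℕ) (t : ℤ),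
      (∀ u : ↥(nonZeroDivisors C.K), (u : C.K) ^ n = 1 → γ u = u ^ m) ∧ (m : ℤ) = n * t + M := by
  obtain ⟨ord, ϖ, hϖ0, -, hordϖ, hmul, hpow, -⟩ := exists_ord' C.k
  have hinj := (algebraMap C.k C.K).injective
  set ϖK : C.K := algebraMap C.k C.K ϖ with hϖK
  have hϖK0 : ϖK ≠ 0 := (map_ne_zero_iff _ hinj).mpr hϖ0
  set P : ↥(nonZeroDivisors C.K) := ⟨ϖK, mem_nonZeroDivisors_of_ne_zero hϖK0⟩ with hP
  have hPfix : ∀ σ : C.K ≃ₐ[C.k] C.K, σ ϖK = ϖK := fun σ => σ.commutes ϖ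
  have hafix : ∀ σ : C.K ≃ₐ[C.k] C.K, σ (γ P : C.K) = γ P :=
    fun σ => unitsHom_equivariant_apply_eq_of_fixed hγ (hPfix σ)
  obtain ⟨a₀, ha₀⟩ := exists_algebraMap_eq_of_fixed' hafix
  have ha₀0 : a₀ ≠ 0 := fun h0 => (nonZeroDivisors.coe_ne_zero (γ P)) (by rw [← ha₀, h0, map_zero])
  refine ⟨-ord a₀, fun N hN => ?_⟩
  obtain ⟨m, hm⟩ := C.unitsHom_exists_pow_eq_on_rootsOfUnity γ hN
  -- Kummer for `ϖ`, read in `k`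
  obtain ⟨β₁, hβ₁0, hβ₁fix, hβ₁⟩ := unitsHom_exists_kummer_relation hγ hN hm P
  obtain ⟨b₁, hb₁⟩ := exists_algebraMap_eq_of_fixed' (fun σ => hβ₁fix σ (hPfix σ))
  have hb₁0 : b₁ ≠ 0 := fun h0 => hβ₁0 (by rw [← hb₁, h0, map_zero])
  have hrel₁ : a₀ = b₁ ^ N * ϖ ^ m := hinj (by
    rw [ha₀, map_mul, map_pow, map_pow, hb₁]; exact hβ₁)
  have hord₁ : ord a₀ = N * ord b₁ + m * ord ϖ := by
    rw [hrel₁, hmul _ _ (pow_ne_zero _ hb₁0) (pow_ne_zero _ hϖ0), hpow _ _ hb₁0, hpow _ _ hϖ0]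
  rw [hordϖ] at hord₁
  exact ⟨m, ord b₁, hm, by linarith⟩

/-! ## Step 4′: conclusion — `γ` is a power map `x ↦ xᴹ`, `M ∈ ℤ` -/

/-- **An equivariant group ENDOMORPHISM of `k̄^×` over the identity of `G_k` is a power map `x ↦ xᴹ` with
`M ∈ ℤ`** (`M = -ord_k γ(ϖ)` for any uniformiser `ϖ` of `k`): the classification of the endomorphisms of the
model `TLG`-object of [AbsTopIII] Def. 3.1 (ii) over `id_{G_k}`.  Proof: by Steps 2 and 3′, for `x ∈ k̄^×` and
every `n`, `γ(x)/xᴹ = (β xᵗ)ⁿ` with `β xᵗ ∈ k(x)`; so `γ(x)/xᴹ ∈ ⋂ₙ (k(x)ˣ)ⁿ = 1`, `k(x)` being a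
non-archimedean local field. [cite: MochizukiAbsTopIII2015, Proposition 3.3 (ii) p.74] -/
theorem nonZeroDivisors_monoidHom_eq_zpow
    (γ : ↥(nonZeroDivisors C.K) →* ↥(nonZeroDivisors C.K))
    (hγ : ∀ (σ : C.K ≃ₐ[C.k] C.K) (x : ↥(nonZeroDivisors C.K)),
      (γ ⟨σ • (x : C.K), smul_mem_nonZeroDivisors σ x.2⟩ : C.K) = σ • (γ x : C.K)) :
    ∃ M : ℤ, ∀ x : ↥(nonZeroDivisors C.K), (γ x : C.K) = (x : C.K) ^ M := by
  obtain ⟨M, hM⟩ := unitsHom_exists_exponent_congr hγ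
  refine ⟨M, fun x => ?_⟩
  have hx0 : (x : C.K) ≠ 0 := nonZeroDivisors.coe_ne_zero x
  set E : IntermediateField C.k C.K := IntermediateField.adjoin C.k ({(x : C.K)} : Set C.K) with hE
  have hxk : IsIntegral C.k (x : C.K) := (Algebra.IsAlgebraic.isAlgebraic (x : C.K)).isIntegral
  haveI : FiniteDimensional C.k E := IntermediateField.adjoin.finiteDimensional hxk
  letI := FiniteExtension.valuativeRel C.k E
  letI := FiniteExtension.topologicalSpace C.k E
  haveI := FiniteExtension.isNonarchimedeanLocalField C.k E
  have hxE : (x : C.K) ∈ E := IntermediateField.mem_adjoin_simple_self C.k (x : C.K)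
  have hγxE : (γ x : C.K) ∈ E :=
    mem_adjoin_of_fixed' (fun τ hτ => unitsHom_equivariant_apply_eq_of_fixed hγ hτ)
  set q : C.K := (γ x : C.K) / (x : C.K) ^ M with hq
  have hq0 : q ≠ 0 := div_ne_zero (nonZeroDivisors.coe_ne_zero (γ x)) (zpow_ne_zero _ hx0)
  have hqE : q ∈ E := div_mem hγxE (zpow_mem hxE _)
  -- `q` has `n`-th roots in `E` for every `n`
  have hroots : ∀ n : ℕ, 0 < n → ∃ δ : C.K, δ ∈ E ∧ δ ^ n = q := by
    intro n hn
    obtain ⟨m, t, hm, hmt⟩ := hM n hn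
    obtain ⟨β, hβ0, hβfix, hβ⟩ := unitsHom_exists_kummer_relation hγ hn hm x
    have hβE : β ∈ E := mem_adjoin_of_fixed' hβfix
    refine ⟨β * (x : C.K) ^ t, mul_mem hβE (zpow_mem hxE t), ?_⟩
    have hxm : (x : C.K) ^ m = ((x : C.K) ^ t) ^ n * (x : C.K) ^ M := by
      rw [← zpow_natCast (x : C.K) m, hmt, zpow_add₀ hx0, mul_comm (n : ℤ) t, zpow_mul, zpow_natCast]
    rw [hq, hβ, hxm, mul_pow, ← mul_assoc, mul_div_assoc, div_self (zpow_ne_zero _ hx0), mul_one]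
  -- in the local field `E`, `⋂ₙ (E^×)ⁿ = 1`
  set qE : E := ⟨q, hqE⟩ with hqEdef
  have hqE0 : qE ≠ 0 := fun h => hq0 (congrArg (fun z : E => (z : C.K)) h)
  have hone : Units.mk0 qE hqE0 = 1 := by
    refine eq_one_of_forall_exists_pow_eq E (Units.mk0 qE hqE0) fun n hn => ?_
    obtain ⟨δ, hδE, hδ⟩ := hroots n hn
    have hδn : (⟨δ, hδE⟩ : E) ^ n = qE := Subtype.ext (by
      rw [SubmonoidClass.coe_pow]; exact hδ)
    have hδ0 : (⟨δ, hδE⟩ : E) ≠ 0 := by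
      intro h0
      rw [h0, zero_pow hn.ne'] at hδn
      exact hqE0 hδn.symm
    exact ⟨Units.mk0 _ hδ0, Units.ext (by simpa using hδn)⟩
  have hq1 : q = 1 := by
    have h := congrArg (fun u : Eˣ => ((u : E) : C.K)) hone
    simpa [hqEdef] using h
  have : (γ x : C.K) = q * (x : C.K) ^ M := by rw [hq, div_mul_cancel₀ _ (zpow_ne_zero _ hx0)]
  rw [this, hq1, one_mul]

/-- `2 ∈ k̄^×` (characteristic `0`). [folklore] -/
private theorem two_mem_nonZeroDivisors : (2 : C.K) ∈ nonZeroDivisors C.K := by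
  haveI : CharZero C.K := charZero_of_injective_algebraMap (algebraMap C.k C.K).injective
  exact mem_nonZeroDivisors_of_ne_zero two_ne_zero

/-- In characteristic `0`, `2 ^ d = 1` (`d ∈ ℤ`) forces `d = 0`. [folklore] -/
private theorem eq_zero_of_two_zpow_eq_one {d : ℤ} (h : (2 : C.K) ^ d = 1) : d = 0 := by
  haveI : CharZero C.K := charZero_of_injective_algebraMap (algebraMap C.k C.K).injective
  have key : ∀ n : ℕ, (2 : C.K) ^ n = 1 → n = 0 := by
    intro n hn
    have hcast : ((2 ^ n : ℕ) : C.K) = ((2 ^ 0 : ℕ) : C.K) := by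
      rw [Nat.cast_pow, Nat.cast_pow, Nat.cast_ofNat, hn, pow_zero]
    exact Nat.pow_right_injective (le_refl 2) (Nat.cast_injective hcast)
  rcases le_or_gt 0 d with hd | hd
  · have h1 : (2 : C.K) ^ d.toNat = 1 := by rw [← zpow_natCast, Int.toNat_of_nonneg hd]; exact h
    have := key d.toNat h1
    omega
  · have h1 : (2 : C.K) ^ (-d).toNat = 1 := by
      rw [← zpow_natCast, Int.toNat_of_nonneg (by omega), zpow_neg, h, inv_one]
    have := key (-d).toNat h1
    omega

/-- **The exponent is unique**: if `xᴹ = xᴹ′` for every `x ∈ k̄^×` then `M = M′` (test at `x = 2`,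
characteristic `0`).  So `γ ↦ M` is a well-defined map `End_{id}((G_k ↷ k̄^×)) → ℤ`.
[cite: MochizukiAbsTopIII2015, Proposition 3.3 (ii) p.74] -/
theorem zpow_exponent_unique {M M' : ℤ}
    (h : ∀ x : ↥(nonZeroDivisors C.K), (x : C.K) ^ M = (x : C.K) ^ M') : M = M' := by
  haveI : CharZero C.K := charZero_of_injective_algebraMap (algebraMap C.k C.K).injective
  have h2 := h ⟨2, two_mem_nonZeroDivisors⟩
  have hd : (2 : C.K) ^ (M - M') = 1 := by
    rw [zpow_sub₀ (two_ne_zero), div_eq_one_iff_eq (zpow_ne_zero _ two_ne_zero)]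
    exact h2
  have := eq_zero_of_two_zpow_eq_one (C := C) hd
  omega

variable (C) in
/-- **Every `M ∈ ℤ` occurs**: `x ↦ xᴹ` is a `G_k`-equivariant group endomorphism of `k̄^×` over `id_{G_k}`
(`σ(xᴹ) = σ(x)ᴹ`).  With `nonZeroDivisors_monoidHom_eq_zpow` and `zpow_exponent_unique`:
`End_{id}((G_k ↷ k̄^×)) = {x ↦ xᴹ : M ∈ ℤ}`, in bijection with `ℤ`.
[cite: MochizukiAbsTopIII2015, Proposition 3.3 (ii) p.74] -/
theorem exists_equivariant_unitsHom_zpow (M : ℤ) :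
    ∃ γ : ↥(nonZeroDivisors C.K) →* ↥(nonZeroDivisors C.K),
      (∀ (σ : C.K ≃ₐ[C.k] C.K) (x : ↥(nonZeroDivisors C.K)),
        (γ ⟨σ • (x : C.K), smul_mem_nonZeroDivisors σ x.2⟩ : C.K) = σ • (γ x : C.K)) ∧
      ∀ x : ↥(nonZeroDivisors C.K), (γ x : C.K) = (x : C.K) ^ M := by
  refine ⟨{ toFun := fun x => ⟨(x : C.K) ^ M,
              mem_nonZeroDivisors_of_ne_zero (zpow_ne_zero _ (nonZeroDivisors.coe_ne_zero x))⟩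
            map_one' := Subtype.ext (by simp)
            map_mul' := fun a b => Subtype.ext (by
              show ((a * b : ↥(nonZeroDivisors C.K)) : C.K) ^ M = (a : C.K) ^ M * (b : C.K) ^ M
              rw [Submonoid.coe_mul, mul_zpow]) }, fun σ x => ?_, fun x => rfl⟩
  show (σ • (x : C.K)) ^ M = σ • ((x : C.K) ^ M)
  rw [AlgEquiv.smul_def, AlgEquiv.smul_def, map_zpow₀]

/-- **Composition multiplies exponents**: `(x ↦ xᴺ) ≫ (x ↦ xᴹ) = (x ↦ x^{N·M})` — with
`nonZeroDivisors_monoidHom_eq_zpow`, `zpow_exponent_unique` and `exists_equivariant_unitsHom_zpow`, the map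
`γ ↦ M` is an isomorphism of monoids `End_{id}((G_k ↷ k̄^×)) ≅ (ℤ, ·)`.
[cite: MochizukiAbsTopIII2015, Proposition 3.3 (ii) p.74] -/
theorem zpow_exponent_comp {γ δ : ↥(nonZeroDivisors C.K) →* ↥(nonZeroDivisors C.K)} {M N : ℤ}
    (hγ : ∀ x : ↥(nonZeroDivisors C.K), (γ x : C.K) = (x : C.K) ^ M)
    (hδ : ∀ x : ↥(nonZeroDivisors C.K), (δ x : C.K) = (x : C.K) ^ N) (x : ↥(nonZeroDivisors C.K)) :
    ((γ.comp δ) x : C.K) = (x : C.K) ^ (N * M) := by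
  rw [MonoidHom.comp_apply, hγ, hδ, ← zpow_mul]

/-- **`End_{id}((G_k ↷ k̄^×))` is commutative**: any two `G_k`-equivariant group endomorphisms of `k̄^×` over
`id_{G_k}` commute (both are power maps). [cite: MochizukiAbsTopIII2015, Proposition 3.3 (ii) p.74] -/
theorem nonZeroDivisors_monoidHom_comm
    (γ δ : ↥(nonZeroDivisors C.K) →* ↥(nonZeroDivisors C.K))
    (hγ : ∀ (σ : C.K ≃ₐ[C.k] C.K) (x : ↥(nonZeroDivisors C.K)),
      (γ ⟨σ • (x : C.K), smul_mem_nonZeroDivisors σ x.2⟩ : C.K) = σ • (γ x : C.K))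
    (hδ : ∀ (σ : C.K ≃ₐ[C.k] C.K) (x : ↥(nonZeroDivisors C.K)),
      (δ ⟨σ • (x : C.K), smul_mem_nonZeroDivisors σ x.2⟩ : C.K) = σ • (δ x : C.K)) :
    γ.comp δ = δ.comp γ := by
  obtain ⟨M, hM⟩ := nonZeroDivisors_monoidHom_eq_zpow γ hγ
  obtain ⟨N, hN⟩ := nonZeroDivisors_monoidHom_eq_zpow δ hδ
  refine MonoidHom.ext fun x => Subtype.ext ?_
  rw [zpow_exponent_comp hM hN, zpow_exponent_comp hN hM, mul_comm]

end MLFClosure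

end Literature.AnabelianGeometry.AbsoluteAnabelian

end
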